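import Summits.CriticalPhenomena.CardyFormulaZ2.Theorems.CardyBoundaryCoulombGasRectilinearCardyDirichletGreenPos
import Literature.Probability.Percolation.BoxCrossingJordan

/-!
# Stub `stub_kernelScalingLimit`, part (b): the total cube-root kernel mass is eventually positive
# (line `excursion-kernel-covariance`, crux `RectilinearCardy`, stmt-CriticalPhenomena-5660)

Part (b) of the registered Prop `KernelScalingLimit` of the line skeleton asks that, for small mesh
`δ`, the `W`-mass of the whole discrete arc `(b → c → d)_δ` be positive, where
`W(v) = (K_δ(v,a_δ) K_δ(v,b_δ) K_δ(v,d_δ))^{1/3}` is the cube-root weight built from the Dirichlet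
Green function `K_δ = dirichletGreen Ω_δ` of the discrete domain `Ω_δ = meshDomain Ω δ` and the
nearest mesh-boundary representatives `a_δ, b_δ, d_δ` of the marks `a = pt 0`, `b = pt 1`, `d = pt 3`
(Hilbert-`ε` choices). We prove it for EVERY conformal rectangle (rectilinearity is not needed), with
the skeleton's definitions `kernelMass`, `cubeRootWeight`, `excursionKernel`, `domainFinset`,
`markRep`, `tailArc` inlined over tree vocabulary (`eventually_kernelMass_mark_one_pos`).

Proof. (i) By the RSW non-degeneracy of conformal-rectangle crossings (tree theorem
`discreteCrossingProb_clusterPt_mem_Ioo_holds`: every cluster point of the crossing probability as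
`δ → 0⁺` lies in `(0,1)`), the crossing probability is eventually positive
(`eventually_discreteCrossingProb_pos`), so the crossing event is nonempty and the discrete arc of
`(cd) = arc 2` — hence, by monotonicity of `discreteArc`, the discrete arc of `(b → d)` — has a
vertex `y`. (ii) The mesh boundary is then finite and nonempty, so nearest representatives of the
marks exist and the `ε`-chosen ones lie in `meshBoundary ⊆ meshDomain`. (iii) By the bulk theorem
`JordanDomain.exists_forall_mem_meshDomain_and_reachable` the discrete domain is eventually a single
mesh component, so `y` is joined inside `Ω_δ` to each representative, and the three Green functions
at `y` are positive (`dirichletGreen_meshDomain_pos_of_meshReachable`, file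
`CardyBoundaryCoulombGasRectilinearCardyDirichletGreenPos.lean`). (iv) The finite sum of the
non-negative weights over the discrete arc dominates the positive weight of `y`.
-/

noncomputable section

open Set Filter Topology
open Literature.Probability.RandomPlanarGeometry
open Literature.Probability.LatticeModels
open Literature.Probability.Percolation (discreteCrossingProb discreteCrossing half
  discreteCrossingProb_clusterPt_mem_Ioo_holds)

namespace Summit.CriticalPhenomena.CardyFormulaZ2.Cruxes.RectilinearCardy.ExcursionKernelCovariance

/-! ### Eventual positivity of the crossing probability and a vertex on the discrete arc `(b → d)_δ` -/

/-- **RSW makes the crossing probability eventually positive**: for every conformal rectangle,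
`0 < P_{1/2}[(ab)_δ ↔ (cd)_δ in Ω_δ]` for all small `δ > 0` (otherwise `0` would be a cluster point
of the crossing probability at `0⁺`, contradicting `discreteCrossingProb_clusterPt_mem_Ioo_holds`).
[folklore] -/
theorem eventually_discreteCrossingProb_pos (R : ConformalRectangle) :
    ∀ᶠ δ in 𝓝[>] (0 : ℝ), 0 < discreteCrossingProb half R.carrier δ (R.arc 0) (R.arc 2) := by
  by_contra h
  have hfr : ∃ᶠ δ in 𝓝[>] (0 : ℝ), discreteCrossingProb half R.carrier δ (R.arc 0) (R.arc 2) = 0 := by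
    refine (Filter.not_eventually.1 h).mono fun δ hδ => ?_
    exact le_antisymm (not_lt.1 hδ) MeasureTheory.measureReal_nonneg
  have hc : MapClusterPt (0 : ℝ) (𝓝[>] 0)
      fun δ => discreteCrossingProb half R.carrier δ (R.arc 0) (R.arc 2) := by
    rw [mapClusterPt_iff_frequently]
    intro s hs
    exact hfr.mono fun δ hδ => by rw [hδ]; exact mem_of_mem_nhds hs
  exact lt_irrefl (0 : ℝ) (discreteCrossingProb_clusterPt_mem_Ioo_holds R hc).1

/-- The marked point `a = pt 0` is not on the arc `boundary '' [mark 1, mark 3]` (injectivity of the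
boundary loop on `[0, 1)`). [folklore] -/
theorem pt_zero_notMem_boundary_image_Icc (R : ConformalRectangle) :
    R.pt 0 ∉ R.boundary '' Icc (R.mark 1) (R.mark 3) := by
  rintro ⟨t, ht, hta⟩
  have ht0 : t ∈ Ico (0 : ℝ) 1 :=
    ⟨(R.mark_mem 1).1.trans ht.1, lt_of_le_of_lt ht.2 (R.mark_mem 3).2⟩
  have heq : t = R.mark 0 := R.injOn_boundary ht0 (R.mark_mem 0) hta
  have hlt : R.mark 0 < R.mark 1 := R.strictMono_mark (show (0 : Fin 4) < 1 by decide)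
  linarith [ht.1]

/-- The arc `(cd) = arc 2` is contained in `boundary '' [mark 1, mark 3]`. [folklore] -/
theorem arc_two_subset_boundary_image_Icc (R : ConformalRectangle) :
    R.arc 2 ⊆ R.boundary '' Icc (R.mark 1) (R.mark 3) := by
  have h3 : R.nextMark 2 = R.mark 3 := by
    unfold MarkedDomain.nextMark
    rw [dif_pos (by decide)]
    rfl
  have h12 : R.mark 1 ≤ R.mark 2 := (R.strictMono_mark (show (1 : Fin 4) < 2 by decide)).le
  unfold MarkedDomain.arc
  rw [h3]
  exact image_mono (Icc_subset_Icc_left h12)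

/-- A vertex of the discrete arc of `(cd)` is a vertex of the discrete arc of `(b → c → d)`
(`discreteArc` is monotone in the arc as long as the larger arc misses a frontier point, here `a`).
[folklore] -/
theorem mem_discreteArc_boundary_image_Icc_of_mem_arc_two (R : ConformalRectangle) {δ : ℝ}
    {x : Site 2} (hx : x ∈ discreteArc R.carrier δ (R.arc 2)) :
    x ∈ discreteArc R.carrier δ (R.boundary '' Icc (R.mark 1) (R.mark 3)) := by
  rw [mem_discreteArc_iff] at hx ⊢
  refine ⟨hx.1, ?_⟩
  have hsub := arc_two_subset_boundary_image_Icc R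
  calc Metric.infDist (meshPoint δ x) (R.boundary '' Icc (R.mark 1) (R.mark 3))
      ≤ Metric.infDist (meshPoint δ x) (R.arc 2) :=
        Metric.infDist_le_infDist_of_subset hsub ⟨R.pt 2, R.pt_mem_arc_self 2⟩
    _ ≤ Metric.infDist (meshPoint δ x) (frontier R.carrier \ R.arc 2) := hx.2
    _ ≤ Metric.infDist (meshPoint δ x) (frontier R.carrier \ R.boundary '' Icc (R.mark 1) (R.mark 3)) :=
        Metric.infDist_le_infDist_of_subset (fun z hz => ⟨hz.1, fun h => hz.2 (hsub h)⟩)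
          ⟨R.pt 0, R.pt_mem_frontier 0, pt_zero_notMem_boundary_image_Icc R⟩

/-- **The discrete arc `(b → c → d)_δ` is eventually nonempty** (every conformal rectangle): for
small `δ` the crossing event `(ab)_δ ↔ (cd)_δ` has positive probability, hence is nonempty, and its
target vertex lies on the discrete arc of `(cd) ⊆ (b → d)`. [folklore] -/
theorem eventually_discreteArc_boundary_image_Icc_nonempty (R : ConformalRectangle) :
    ∀ᶠ δ in 𝓝[>] (0 : ℝ),
      (discreteArc R.carrier δ (R.boundary '' Icc (R.mark 1) (R.mark 3))).Nonempty := by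
  filter_upwards [eventually_discreteCrossingProb_pos R] with δ hP
  have hne : (discreteCrossing R.carrier δ (R.arc 0) (R.arc 2)).Nonempty := by
    by_contra h0
    rw [Set.not_nonempty_iff_eq_empty] at h0
    unfold discreteCrossingProb at hP
    rw [h0, MeasureTheory.measureReal_empty] at hP
    exact lt_irrefl _ hP
  obtain ⟨ω, hω⟩ := hne
  obtain ⟨x, -, y, hy, -⟩ := (Literature.Probability.Percolation.mem_discreteCrossing_iff).1 hω
  exact ⟨y, mem_discreteArc_boundary_image_Icc_of_mem_arc_two R hy⟩

/-! ### The nearest mesh-boundary representative of a point -/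

/-- If the mesh boundary is finite and nonempty, the Hilbert-`ε` nearest mesh-boundary vertex to a
point `z` is a genuine mesh-boundary vertex (a minimiser of the distance exists). [folklore] -/
theorem epsilon_nearest_mem_meshBoundary {Ω : Set ℂ} {δ : ℝ} (hfin : (meshBoundary Ω δ).Finite)
    (hne : (meshBoundary Ω δ).Nonempty) (z : ℂ) :
    (Classical.epsilon fun x : Site 2 => x ∈ meshBoundary Ω δ ∧
        ∀ y ∈ meshBoundary Ω δ, dist (meshPoint δ x) z ≤ dist (meshPoint δ y) z) ∈
      meshBoundary Ω δ := by
  have hex : ∃ x : Site 2, x ∈ meshBoundary Ω δ ∧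
      ∀ y ∈ meshBoundary Ω δ, dist (meshPoint δ x) z ≤ dist (meshPoint δ y) z :=
    Set.exists_min_image (meshBoundary Ω δ) (fun x => dist (meshPoint δ x) z) hfin hne
  exact (Classical.epsilon_spec hex).1

/-! ### Part (b) of `KernelScalingLimit` -/

/-- **Part (b) of `KernelScalingLimit`, for every conformal rectangle**: eventually in `δ → 0⁺` the
total cube-root kernel mass of the discrete arc `(b → c → d)_δ` is positive,
`0 < ∑ᶠ_{v ∈ (∂Ω[mark 1, mark 3])_δ} (K_δ(v,a_δ) K_δ(v,b_δ) K_δ(v,d_δ))^{1/3}`, with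
`K_δ = dirichletGreen Ω_δ` and `a_δ, b_δ, d_δ` the `ε`-chosen nearest mesh-boundary vertices to
`pt 0, pt 1, pt 3` — the skeleton's `0 < kernelMass R δ (R.mark 1)` with `kernelMass`,
`cubeRootWeight`, `excursionKernel`, `domainFinset`, `markRep`, `tailArc` unfolded. [folklore] -/
theorem eventually_kernelMass_mark_one_pos (R : ConformalRectangle) :
    ∀ᶠ δ in 𝓝[>] (0 : ℝ),
      0 < ∑ᶠ v ∈ discreteArc R.carrier δ (R.boundary '' Icc (R.mark 1) (R.mark 3)),
        (dirichletGreen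
              (if h : 0 < δ then (meshDomain_finite (Ω := R.carrier) R.isBounded h).toFinset else ∅) v
              (Classical.epsilon fun x : Site 2 => x ∈ meshBoundary R.carrier δ ∧
                ∀ y ∈ meshBoundary R.carrier δ,
                  dist (meshPoint δ x) (R.pt 0) ≤ dist (meshPoint δ y) (R.pt 0)) *
            dirichletGreen
              (if h : 0 < δ then (meshDomain_finite (Ω := R.carrier) R.isBounded h).toFinset else ∅) v
              (Classical.epsilon fun x : Site 2 => x ∈ meshBoundary R.carrier δ ∧
                ∀ y ∈ meshBoundary R.carrier δ,
                  dist (meshPoint δ x) (R.pt 1) ≤ dist (meshPoint δ y) (R.pt 1)) *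
          dirichletGreen
            (if h : 0 < δ then (meshDomain_finite (Ω := R.carrier) R.isBounded h).toFinset else ∅) v
            (Classical.epsilon fun x : Site 2 => x ∈ meshBoundary R.carrier δ ∧
              ∀ y ∈ meshBoundary R.carrier δ,
                dist (meshPoint δ x) (R.pt 3) ≤ dist (meshPoint δ y) (R.pt 3))) ^ (1 / 3 : ℝ) := by
  -- the bulk theorem: eventually `Ω_δ` is a single mesh component
  obtain ⟨δ₀, hδ₀, hbulk⟩ := R.toJordanDomain.exists_forall_mem_meshDomain_and_reachable
    isCompact_empty (empty_subset _)
  have hlt : ∀ᶠ δ in 𝓝[>] (0 : ℝ), δ < δ₀ := mem_nhdsWithin_of_mem_nhds (Iio_mem_nhds hδ₀)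
  have hposδ : ∀ᶠ δ in 𝓝[>] (0 : ℝ), 0 < δ := eventually_mem_nhdsWithin
  filter_upwards [hposδ, hlt, eventually_discreteArc_boundary_image_Icc_nonempty R] with δ hδ hδlt hne
  simp only [dif_pos hδ]
  obtain ⟨y, hy⟩ := hne
  -- finiteness of the discrete arc and reduction to the weight of `y`
  have hfin : (discreteArc R.carrier δ (R.boundary '' Icc (R.mark 1) (R.mark 3))).Finite :=
    (meshDomain_finite R.isBounded hδ).subset
      ((discreteArc_subset_meshBoundary _ _ _).trans (meshBoundary_subset_meshDomain _ _))
  rw [finsum_mem_eq_finite_toFinset_sum _ hfin]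
  refine lt_of_lt_of_le ?_ (Finset.single_le_sum (fun v _ => Real.rpow_nonneg (mul_nonneg (mul_nonneg
    (dirichletGreen_nonneg (by norm_num) _ _ _) (dirichletGreen_nonneg (by norm_num) _ _ _))
    (dirichletGreen_nonneg (by norm_num) _ _ _)) _) (hfin.mem_toFinset.2 hy))
  -- the weight of `y` is positive: `y` is joined inside `Ω_δ` to the three representatives
  have hyB : y ∈ meshBoundary R.carrier δ := discreteArc_subset_meshBoundary _ _ _ hy
  have hyD : y ∈ meshDomain R.carrier δ := meshBoundary_subset_meshDomain _ _ hyB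
  have hBfin : (meshBoundary R.carrier δ).Finite :=
    (meshDomain_finite R.isBounded hδ).subset (meshBoundary_subset_meshDomain _ _)
  have hK : ∀ z : ℂ, 0 < dirichletGreen (meshDomain_finite R.isBounded hδ).toFinset y
      (Classical.epsilon fun x : Site 2 => x ∈ meshBoundary R.carrier δ ∧
        ∀ y ∈ meshBoundary R.carrier δ, dist (meshPoint δ x) z ≤ dist (meshPoint δ y) z) := by
    intro z
    have hrep := meshBoundary_subset_meshDomain _ _ (epsilon_nearest_mem_meshBoundary hBfin ⟨y, hyB⟩ z)
    obtain ⟨hy', hm', hr⟩ := (hbulk δ hδ hδlt).2 y hyD _ hrep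
    exact dirichletGreen_meshDomain_pos_of_meshReachable R.isBounded hδ hyD hr
  exact Real.rpow_pos_of_pos (mul_pos (mul_pos (hK _) (hK _)) (hK _)) _

end Summit.CriticalPhenomena.CardyFormulaZ2.Cruxes.RectilinearCardy.ExcursionKernelCovariance
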